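import Literature.NumberTheory.CubicFields.ShintaniCoeffFundamental
import Literature.NumberTheory.CubicFields.UniformityEstimate
import Literature.NumberTheory.QuadraticFields.LocalFundamental
import Mathlib.NumberTheory.ArithmeticFunction.Moebius
import Mathlib.RingTheory.Coprime.Lemmas
import HarnessLib

/-!
# BTT §5, display (20) for `Σ_p = A'_p`: the sieve from the congruence counts `N^±(X, Ψ_{q²})` to the forms of fundamental discriminant

Topic `Literature/NumberTheory/CubicFields`. Bhargava–Taniguchi–Thorne 2023 prove the count (3) of
cubic fields of fundamental discriminant (⟺ Thm 1.2) in §5 with `M = 1` and the local specification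
`Σ_p = A'_p` (not totally ramified) at every `p`: "To carry out the sieve, for each prime `p` we write
`Ψ_{p²}` for the characteristic function of … those `x ∈ V(ℤ/p²ℤ)` that are nonmaximal at `p` or have
a triple root `(mod p)`. When `p > 2`, this is equivalent to requiring that `p² ∣ Disc(x)` … For each
squarefree `q` we view `Ψ_{q²} := ⊗_{p∣q} Ψ_{p²}` … inclusion–exclusion give
`N^±_{≤3}(X, Σ) = Σ_q μ(q) N^±(X, Ψ_{q²})` (20)", where `N^±(X, Φ) = Σ_{x ∈ GL₂(ℤ)\V(ℤ), 0<±Disc x<X}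
Φ(x)/|Stab(x)|` (Thm 3.1 (17)). This file PROVES (20) on the tree's objects, with the sieving sets
spelled through the DISCRIMINANT: `x` is sieved out at `p` iff `Disc(x)` is not locally fundamental at
`p` (`QuadraticFields.IsFundAt`: `p² ∤ D` at odd `p` — BTT's "`p² ∣ Disc(x)`" — and `D ≡ 1 (4)` or
`D ≡ 8, 12 (16)` at `p = 2`), so that the sieved set `{x : Disc x locally fundamental at every p}` is
`{x : Disc x fundamental} ∪ {x : Disc x = 1}` (`isFundamental_iff_forall_isFundAt`):

* `nonFundCount s q X` — **`N^±(X, Ψ_{q²}) = Σ_{D ∈ discWindow s X, D not loc. fund. at any p ∣ q} a(D)`**,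
  `a(D) = Σ_{orbits of disc D} 1/|Stab|` (`shintaniCoeffReal`): the weighted number of `GL₂(ℤ)`-orbits
  `x` with `0 < s·Disc x < X` sieved out at every `p ∣ q`;
* `sum_moebius_mul_nonFundCount` — **(20)**: `Σ_{1 ≤ q ≤ X} μ(q) · nonFundCount s q X =
  Σ_{D ∈ discWindow s X, D loc. fund. everywhere} a(D)` (Möbius over the product `B(D)` of the primes
  at which `D ≡ 0, 1 (4)` is not locally fundamental; `a(D) = 0` for `D ≡ 2, 3 (4)`);
* `sum_locFund_shintaniCoeffReal_neg/pos` — that right side is `N⁻_{3,fund}(X) + ½ #negFundDiscrs X`,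
  resp. `N⁺_{3,fund}(X) + ½ #posFundDiscrs X + [1 < X]·a(1)` (`shintaniCoeffReal_of_isFundamental`:
  `a(D) = cubicFieldCountOfDisc D + ½`; the orbit `ℤ³` of discriminant `1` is locally fundamental);
* `nonFundCount_le_sum_classNumber`, `exists_nonFundCount_le` — the tail input `E₃` of §5:
  `N^±(X, Ψ_{q²}) ≤ Σ_{D ∈ window, q² ∣ D} h(D) ≤ C · 6^{ω(q)} X/q²` under `btt_uniformity_sqDvd`
  (BTT Prop. 4.5).

NOT here: the analytic evaluation of `N^±(X, Ψ_{q²})` by Landau's method (Thm 3.2 with the residues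
(13), (15)) and the rest of §5 — `FundCubicFieldCountLandau.lean`, where that evaluation is the
hypothesis.

## References

* M. Bhargava, T. Taniguchi, F. Thorne, *Improved error estimates for the Davenport–Heilbronn
  theorems*, Math. Ann. 389 (2024) = arXiv:2107.12819, §5 (20), Thm 3.1 (17), Prop. 4.5
  [BhargavaTaniguchiThorne2023].
-/

noncomputable section

open Finset ArithmeticFunction
open scoped ArithmeticFunction.Moebius

namespace Literature.NumberTheory.CubicFields

open BinaryCubic RingOfForm Literature.NumberTheory.QuadraticFields Classical

/-! ### `N^±(X, Ψ_{q²})` -/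

/-- **`N^±(X, Ψ_{q²})`** (BTT §5 with Thm 3.1 (17), `Σ_p = A'_p`): the number of `GL₂(ℤ)`-orbits `x`
of integral binary cubic forms with `0 < s · Disc x < X`, weighted by `1/|Stab(x)|`, whose discriminant
is not locally fundamental at any prime `p ∣ q` (odd `p`: `p² ∣ Disc x`; `p = 2`: `Disc x ≡ 0, 4 (16)`),
as the sum of the Shintani coefficients `a(D)` over those `D` in the window. [cite: BhargavaTaniguchiThorne2023, §5 (N^±(X, Ψ_{q²}) of display (20))] -/
def nonFundCount (s : ℤ) (q X : ℕ) : ℝ :=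
  ∑ D ∈ (discWindow s X).filter (fun D => ∀ p ∈ q.primeFactors, ¬ IsFundAt p D), shintaniCoeffReal D

/-- `N^±(X, Ψ_{q²}) ≥ 0`. [folklore] -/
theorem nonFundCount_nonneg (s : ℤ) (q X : ℕ) : 0 ≤ nonFundCount s q X :=
  Finset.sum_nonneg fun D _ => shintaniCoeffReal_nonneg D

/-- `a(D) = 0` unless `D ≡ 0, 1 (mod 4)` (no form has such a discriminant). [folklore] -/
theorem shintaniCoeffReal_eq_zero_of_emod_four {D : ℤ} (hD : D % 4 = 2 ∨ D % 4 = 3) : shintaniCoeffReal D = 0 := by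
  haveI : IsEmpty (orbitsOfDisc D) := ⟨fun ⟨O, f, _, hf⟩ => by rcases disc_emod_four f with h | h <;> omega⟩
  rw [shintaniCoeffReal, finsum_of_isEmpty]

/-! ### The non-fundamental primes of `D` and their product `B(D)` -/

/-- For `D ≡ 0, 1 (mod 4)`, not locally fundamental at `p` means `p² ∣ D` (at `2`: not `≡ 1 (4)`, not
`≡ 8, 12 (16)` leaves `4 ∣ D`). [folklore] -/
theorem sq_dvd_of_not_isFundAt {D : ℤ} (h4 : D % 4 = 0 ∨ D % 4 = 1) {p : ℕ} (h : ¬ IsFundAt p D) :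
    (p : ℤ) ^ 2 ∣ D := by
  by_cases hp2 : p = 2
  · subst hp2
    rw [isFundAt_two] at h
    push Not at h
    have h22 : (((2 : ℕ) : ℤ)) ^ 2 = 4 := by norm_num
    rw [h22]
    rcases h4 with h4 | h4
    · exact Int.dvd_of_emod_eq_zero h4
    · exact absurd h4 h.1
  · rwa [isFundAt_of_ne_two hp2, not_not] at h

/-- The primes dividing `|D|` at which `D` is not locally fundamental. [folklore] -/
def nonFundPrimes (D : ℤ) : Finset ℕ :=
  D.natAbs.primeFactors.filter fun p => ¬ IsFundAt p D

/-- Members of `nonFundPrimes D` are primes at which `D` is not locally fundamental. [folklore] -/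
theorem prime_of_mem_nonFundPrimes {D : ℤ} {p : ℕ} (hp : p ∈ nonFundPrimes D) : p.Prime ∧ ¬ IsFundAt p D :=
  ⟨Nat.prime_of_mem_primeFactors (Finset.mem_filter.mp hp).1, (Finset.mem_filter.mp hp).2⟩

/-- For `D ≡ 0, 1 (mod 4)`, `D ≠ 0`, EVERY prime at which `D` is not locally fundamental lies in
`nonFundPrimes D` (it divides `D`). [folklore] -/
theorem mem_nonFundPrimes {D : ℤ} (h4 : D % 4 = 0 ∨ D % 4 = 1) (hD : D ≠ 0) {p : ℕ} (hp : p.Prime)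
    (h : ¬ IsFundAt p D) : p ∈ nonFundPrimes D := by
  refine Finset.mem_filter.mpr ⟨Nat.mem_primeFactors.mpr ⟨hp, ?_, Int.natAbs_ne_zero.mpr hD⟩, h⟩
  have h1 : (p : ℤ) ∣ D := (dvd_pow_self (p : ℤ) two_ne_zero).trans (sq_dvd_of_not_isFundAt h4 h)
  exact Int.natCast_dvd.mp h1

/-- `B(D) = ∏_{p ∈ nonFundPrimes D} p` divides `|D|`. [folklore] -/
theorem prod_nonFundPrimes_dvd (D : ℤ) : ∏ p ∈ nonFundPrimes D, p ∣ D.natAbs :=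
  (Finset.prod_dvd_prod_of_subset _ _ _ (Finset.filter_subset _ _)).trans (Nat.prod_primeFactors_dvd _)

/-- `B(D) ≠ 0`. [folklore] -/
theorem prod_nonFundPrimes_ne_zero (D : ℤ) : ∏ p ∈ nonFundPrimes D, p ≠ 0 :=
  Finset.prod_ne_zero_iff.mpr fun _ hp => (prime_of_mem_nonFundPrimes hp).1.ne_zero

/-- The prime factors of `B(D)` are `nonFundPrimes D`. [folklore] -/
theorem primeFactors_prod_nonFundPrimes (D : ℤ) : (∏ p ∈ nonFundPrimes D, p).primeFactors = nonFundPrimes D :=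
  Nat.primeFactors_prod fun _ hp => (prime_of_mem_nonFundPrimes hp).1

/-- **For squarefree `q` and `D ≡ 0, 1 (mod 4)`, `D ≠ 0`: `D` is non-fundamental at every `p ∣ q` iff
`q ∣ B(D)`.** [folklore] -/
theorem forall_not_isFundAt_iff_dvd {D : ℤ} (h4 : D % 4 = 0 ∨ D % 4 = 1) (hD : D ≠ 0) {q : ℕ} (hq : Squarefree q) :
    (∀ p ∈ q.primeFactors, ¬ IsFundAt p D) ↔ q ∣ ∏ p ∈ nonFundPrimes D, p := by
  constructor
  · intro h
    rw [← Nat.prod_primeFactors_of_squarefree hq]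
    exact Finset.prod_dvd_prod_of_subset _ _ _ fun p hp =>
      mem_nonFundPrimes h4 hD (Nat.prime_of_mem_primeFactors hp) (h p hp)
  · intro h p hp
    have hsub : q.primeFactors ⊆ (∏ p ∈ nonFundPrimes D, p).primeFactors :=
      Nat.primeFactors_mono h (prod_nonFundPrimes_ne_zero D)
    rw [primeFactors_prod_nonFundPrimes] at hsub
    exact (prime_of_mem_nonFundPrimes (hsub hp)).2

/-- `B(D) = 1` iff `D` is locally fundamental at every prime (`D ≡ 0, 1 (mod 4)`, `D ≠ 0`). [folklore] -/
theorem prod_nonFundPrimes_eq_one_iff {D : ℤ} (h4 : D % 4 = 0 ∨ D % 4 = 1) (hD : D ≠ 0) :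
    ∏ p ∈ nonFundPrimes D, p = 1 ↔ ∀ p : ℕ, p.Prime → IsFundAt p D := by
  constructor
  · intro h1 p hp
    by_contra hnf
    have hmem := mem_nonFundPrimes h4 hD hp hnf
    rw [← primeFactors_prod_nonFundPrimes D, h1, Nat.primeFactors_one] at hmem
    exact Finset.notMem_empty _ hmem
  · intro h
    have hempty : nonFundPrimes D = ∅ := Finset.eq_empty_of_forall_notMem fun p hp =>
      (prime_of_mem_nonFundPrimes hp).2 (h p (prime_of_mem_nonFundPrimes hp).1)
    rw [hempty, Finset.prod_empty]

/-! ### Möbius: `Σ_{q ≤ X} μ(q) [D non-fundamental at all p ∣ q] = [D locally fundamental everywhere]` -/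

/-- `Σ_{d ∣ n} μ(d) = [n = 1]`, real-valued. [folklore] -/
theorem sum_divisors_moebius_real (n : ℕ) :
    ∑ d ∈ n.divisors, ((μ d : ℤ) : ℝ) = if n = 1 then 1 else 0 := by
  have h := congr_arg (fun f : ArithmeticFunction ℤ => f n) ArithmeticFunction.moebius_mul_coe_zeta
  simp only [ArithmeticFunction.coe_mul_zeta_apply, ArithmeticFunction.one_apply] at h
  exact_mod_cast h

/-- **The Möbius step of (20), at one discriminant**: for `D ≡ 0, 1 (mod 4)` with `0 < |D| < X`,
`Σ_{1 ≤ q ≤ X} μ(q) · [D not loc. fund. at every p ∣ q] = [D loc. fund. at every prime]`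
(the `q` that count are the divisors of `B(D) ≤ |D| < X`, and `Σ_{q ∣ B} μ(q) = [B = 1]`). [cite: BhargavaTaniguchiThorne2023, §5 (inclusion–exclusion giving (20))] -/
theorem sum_moebius_ite_forall_not_isFundAt {D : ℤ} (h4 : D % 4 = 0 ∨ D % 4 = 1) (hD : D ≠ 0) {X : ℕ}
    (hX : D.natAbs < X) :
    ∑ q ∈ Finset.Icc 1 X, (if ∀ p ∈ q.primeFactors, ¬ IsFundAt p D then ((μ q : ℤ) : ℝ) else 0) =
      if ∀ p : ℕ, p.Prime → IsFundAt p D then 1 else 0 := by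
  set B := ∏ p ∈ nonFundPrimes D, p with hB
  have hB0 : B ≠ 0 := prod_nonFundPrimes_ne_zero D
  have hBle : B ≤ D.natAbs := Nat.le_of_dvd (Int.natAbs_pos.mpr hD) (prod_nonFundPrimes_dvd D)
  -- replace the condition by `q ∣ B` (equal summands: `μ q = 0` unless `q` is squarefree)
  have hterm : ∀ q ∈ Finset.Icc 1 X,
      (if ∀ p ∈ q.primeFactors, ¬ IsFundAt p D then ((μ q : ℤ) : ℝ) else 0) = if q ∣ B then ((μ q : ℤ) : ℝ) else 0 := by
    intro q _
    by_cases hq : Squarefree q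
    · by_cases hT : ∀ p ∈ q.primeFactors, ¬ IsFundAt p D
      · rw [if_pos hT, if_pos ((forall_not_isFundAt_iff_dvd h4 hD hq).mp hT)]
      · rw [if_neg hT, if_neg (mt (forall_not_isFundAt_iff_dvd h4 hD hq).mpr hT)]
    · rw [ArithmeticFunction.moebius_eq_zero_of_not_squarefree hq]
      simp
  rw [Finset.sum_congr rfl hterm, ← Finset.sum_filter]
  have hset : (Finset.Icc 1 X).filter (fun q => q ∣ B) = B.divisors := by
    ext q
    rw [Finset.mem_filter, Finset.mem_Icc, Nat.mem_divisors]
    constructor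
    · rintro ⟨-, h⟩; exact ⟨h, hB0⟩
    · rintro ⟨h, -⟩
      exact ⟨⟨Nat.pos_of_dvd_of_pos h (Nat.pos_of_ne_zero hB0), (Nat.le_of_dvd (Nat.pos_of_ne_zero hB0) h).trans (hBle.trans hX.le)⟩, h⟩
  rw [hset, sum_divisors_moebius_real]
  by_cases hall : ∀ p : ℕ, p.Prime → IsFundAt p D
  · rw [if_pos hall, if_pos ((prod_nonFundPrimes_eq_one_iff h4 hD).mpr hall)]
  · rw [if_neg hall, if_neg (mt (prod_nonFundPrimes_eq_one_iff h4 hD).mp hall)]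

/-! ### (20): `Σ_q μ(q) N^±(X, Ψ_{q²})` is the weighted count of orbits of locally-fundamental discriminant -/

/-- **BTT (20) with `M = 1`, `Σ_p = A'_p`, on the tree's objects**:
`Σ_{1 ≤ q ≤ X} μ(q) · N^±(X, Ψ_{q²}) = Σ_{D ∈ discWindow s X, D loc. fund. at every prime} a(D)` — the
`1/|Stab|`-weighted number of `GL₂(ℤ)`-orbits in the window whose discriminant is locally fundamental
everywhere (= fundamental, or `= 1`). Only `q ≤ X` matter (`q ∣ B(D) ≤ |D| < X`).
[cite: BhargavaTaniguchiThorne2023, §5 display (20)] -/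
theorem sum_moebius_mul_nonFundCount {s : ℤ} (hs : s = 1 ∨ s = -1) (X : ℕ) :
    ∑ q ∈ Finset.Icc 1 X, ((μ q : ℤ) : ℝ) * nonFundCount s q X =
      ∑ D ∈ (discWindow s X).filter (fun D => ∀ p : ℕ, p.Prime → IsFundAt p D), shintaniCoeffReal D := by
  unfold nonFundCount
  simp_rw [Finset.mul_sum, Finset.sum_filter]
  rw [Finset.sum_comm]
  refine Finset.sum_congr rfl fun D hD => ?_
  have hD' := (mem_discWindow hs).mp hD
  have hD0 : D ≠ 0 := by rintro rfl; simp at hD'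
  have hDX : D.natAbs < X := by
    have : (D.natAbs : ℤ) < X := by
      rw [Int.natCast_natAbs]
      rcases hs with rfl | rfl
      · rw [abs_of_pos (by linarith [hD'.1])]; linarith [hD'.2]
      · rw [abs_of_neg (by linarith [hD'.1])]; linarith [hD'.2]
    exact_mod_cast this
  by_cases h4 : D % 4 = 0 ∨ D % 4 = 1
  · have key := sum_moebius_ite_forall_not_isFundAt h4 hD0 hDX
    calc ∑ q ∈ Finset.Icc 1 X, (if ∀ p ∈ q.primeFactors, ¬ IsFundAt p D then ((μ q : ℤ) : ℝ) * shintaniCoeffReal D else 0)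
        = (∑ q ∈ Finset.Icc 1 X, (if ∀ p ∈ q.primeFactors, ¬ IsFundAt p D then ((μ q : ℤ) : ℝ) else 0)) * shintaniCoeffReal D := by
          rw [Finset.sum_mul]
          refine Finset.sum_congr rfl fun q _ => ?_
          split_ifs <;> simp
      _ = if ∀ p : ℕ, p.Prime → IsFundAt p D then shintaniCoeffReal D else 0 := by
          rw [key]; split_ifs <;> simp
  · have h23 : D % 4 = 2 ∨ D % 4 = 3 := by omega
    simp [shintaniCoeffReal_eq_zero_of_emod_four h23]

/-! ### The sieved count: cubic fields of fundamental discriminant, plus `ℤ × 𝓞_F`, plus `ℤ³` -/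

/-- The locally-everywhere-fundamental `D` in `discWindow (−1) X` are the negative fundamental
discriminants `> −X` (`1` is not negative). [folklore] -/
theorem filter_locFund_discWindow_neg (X : ℕ) :
    (discWindow (-1) X).filter (fun D => ∀ p : ℕ, p.Prime → IsFundAt p D) = negFundDiscrs X := by
  ext D
  rw [Finset.mem_filter, mem_discWindow (Or.inr rfl), mem_negFundDiscrs, isFundamental_iff_forall_isFundAt]
  constructor
  · rintro ⟨h, hf⟩; exact ⟨⟨by linarith [h.2], by linarith [h.1]⟩, by linarith [h.1], hf⟩
  · rintro ⟨h, -, hf⟩; exact ⟨⟨by linarith [h.2], by linarith [h.1]⟩, hf⟩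

/-- The locally-everywhere-fundamental `D ≠ 1` in `discWindow 1 X` are the positive fundamental
discriminants `< X`. [folklore] -/
theorem filter_locFund_discWindow_pos_erase (X : ℕ) :
    ((discWindow 1 X).filter (fun D => ∀ p : ℕ, p.Prime → IsFundAt p D)).erase 1 = posFundDiscrs X := by
  ext D
  rw [Finset.mem_erase, Finset.mem_filter, mem_discWindow (Or.inl rfl), mem_posFundDiscrs, isFundamental_iff_forall_isFundAt]
  constructor
  · rintro ⟨h1, h, hf⟩; exact ⟨⟨by linarith [h.1], by linarith [h.2]⟩, h1, hf⟩
  · rintro ⟨h, h1, hf⟩; exact ⟨h1, ⟨by linarith [h.1], by linarith [h.2]⟩, hf⟩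

/-- **The sieved count, `D < 0`**: `Σ_{D ∈ discWindow (−1) X, loc. fund.} a(D) = N⁻_{3,fund}(X) + ½ #negFundDiscrs X`
(`a(D) = cubicFieldCountOfDisc D + ½` on fundamental `D`: the cubic fields and `ℤ × 𝓞_{ℚ(√D)}`; BTT
Prop. 4.3 `N_{≤3} = N₃ + ½ N₂` in the case `Σ_p = A'_p`, where no cyclic cubic field occurs). [cite: BhargavaTaniguchiThorne2023, Prop. 4.3 with §5 (N^-_{≤3}(X, Σ) for Σ_p = A'_p)] -/
theorem sum_locFund_shintaniCoeffReal_neg (X : ℕ) :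
    ∑ D ∈ (discWindow (-1) X).filter (fun D => ∀ p : ℕ, p.Prime → IsFundAt p D), shintaniCoeffReal D =
      (∑ D ∈ negFundDiscrs X, (cubicFieldCountOfDisc D : ℝ)) + ((negFundDiscrs X).card : ℝ) / 2 := by
  rw [filter_locFund_discWindow_neg, Finset.sum_congr rfl fun D hD =>
    shintaniCoeffReal_of_isFundamental (mem_negFundDiscrs.mp hD).2, Finset.sum_add_distrib, Finset.sum_const,
    nsmul_eq_mul]
  ring

/-- **The sieved count, `D > 0`**: `Σ_{D ∈ discWindow 1 X, loc. fund.} a(D) = N⁺_{3,fund}(X) + ½ #posFundDiscrs X + [1 < X]·a(1)`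
(the extra orbit `ℤ³` of discriminant `1`, locally fundamental everywhere; `a(1) = 1/6`, not needed). [cite: BhargavaTaniguchiThorne2023, Prop. 4.3 with §5 (N^+_{≤3}(X, Σ) for Σ_p = A'_p)] -/
theorem sum_locFund_shintaniCoeffReal_pos (X : ℕ) :
    ∑ D ∈ (discWindow 1 X).filter (fun D => ∀ p : ℕ, p.Prime → IsFundAt p D), shintaniCoeffReal D =
      (∑ D ∈ posFundDiscrs X, (cubicFieldCountOfDisc D : ℝ)) + ((posFundDiscrs X).card : ℝ) / 2 +
        (if 1 < X then shintaniCoeffReal 1 else 0) := by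
  set F := (discWindow 1 X).filter (fun D => ∀ p : ℕ, p.Prime → IsFundAt p D) with hF
  have h1 : (1 : ℤ) ∈ F ↔ 1 < X := by
    rw [hF, Finset.mem_filter, mem_discWindow (Or.inl rfl)]
    constructor
    · rintro ⟨⟨-, h⟩, -⟩; exact_mod_cast (by linarith : (1 : ℤ) < X)
    · intro h; exact ⟨⟨by norm_num, by exact_mod_cast (by omega : 1 * 1 < X)⟩, isFundAt_one⟩
  have hsplit : ∑ D ∈ F, shintaniCoeffReal D = ∑ D ∈ F.erase 1, shintaniCoeffReal D + (if 1 < X then shintaniCoeffReal 1 else 0) := by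
    by_cases hX : 1 < X
    · rw [if_pos hX, Finset.sum_erase_add _ _ (h1.mpr hX)]
    · rw [if_neg hX, add_zero, Finset.erase_eq_of_notMem (fun h => hX (h1.mp h))]
  rw [hsplit, hF, filter_locFund_discWindow_pos_erase, Finset.sum_congr rfl fun D hD =>
    shintaniCoeffReal_of_isFundamental (mem_posFundDiscrs.mp hD).2, Finset.sum_add_distrib, Finset.sum_const,
    nsmul_eq_mul]
  ring

/-! ### The tail input `E₃`: `N^±(X, Ψ_{q²}) ≤ Σ_{D ∈ window, q² ∣ D} h(D)` -/

/-- For squarefree `q` and `D ≡ 0, 1 (mod 4)` non-fundamental at every `p ∣ q`: `q² ∣ D`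
(the `p²`, `p ∣ q`, are pairwise coprime). [folklore] -/
theorem sq_dvd_of_forall_not_isFundAt {D : ℤ} (h4 : D % 4 = 0 ∨ D % 4 = 1) {q : ℕ} (hq : Squarefree q)
    (h : ∀ p ∈ q.primeFactors, ¬ IsFundAt p D) : (q : ℤ) ^ 2 ∣ D := by
  have hq' : ((q : ℕ) : ℤ) ^ 2 = ∏ p ∈ q.primeFactors, ((p : ℤ)) ^ 2 := by
    rw [Finset.prod_pow, ← Nat.cast_prod, Nat.prod_primeFactors_of_squarefree hq]
  rw [hq']
  refine Finset.prod_dvd_of_coprime ?_ fun p hp => sq_dvd_of_not_isFundAt h4 (h p hp)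
  intro p hp p' hp' hne
  have hcop : Nat.Coprime (p ^ 2) (p' ^ 2) :=
    ((Nat.coprime_primes (Nat.prime_of_mem_primeFactors hp) (Nat.prime_of_mem_primeFactors hp')).mpr hne).pow 2 2
  have := Nat.isCoprime_iff_coprime.mpr hcop
  simpa using this

/-- **`N^±(X, Ψ_{q²}) ≤ Σ_{D ∈ discWindow s X, q² ∣ D} h(D)`** for squarefree `q`: the orbits sieved out
at every `p ∣ q` have `q² ∣ Disc` (`a(D) ≤ h(D)`, and `a(D) = 0` off `D ≡ 0, 1 (4)`) — the population
bounded by BTT Prop. 4.5. [cite: BhargavaTaniguchiThorne2023, §5 (E₃ ≤ Σ_{q>Q} N^±(X, Ψ_{q²}), bounded by Prop. 4.5)] -/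
theorem nonFundCount_le_sum_classNumber {s : ℤ} (hs : s = 1 ∨ s = -1) {q : ℕ} (hq : Squarefree q) (X : ℕ) :
    nonFundCount s q X ≤ ((∑ D ∈ (discWindow s X).filter (fun D => (q : ℤ) ^ 2 ∣ D), classNumber D : ℕ) : ℝ) := by
  unfold nonFundCount
  push_cast
  rw [Finset.sum_filter, Finset.sum_filter]
  refine Finset.sum_le_sum fun D hD => ?_
  have hD0 : D ≠ 0 := by
    rintro rfl; have := (mem_discWindow hs).mp hD; simp at this
  by_cases h4 : D % 4 = 0 ∨ D % 4 = 1
  · split_ifs with hT hq2 hq2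
    · exact shintaniCoeffReal_le_classNumber hD0
    · exact absurd (sq_dvd_of_forall_not_isFundAt h4 hq hT) hq2
    · exact Nat.cast_nonneg _
    · exact le_rfl
  · have h23 : D % 4 = 2 ∨ D % 4 = 3 := by omega
    rw [shintaniCoeffReal_eq_zero_of_emod_four h23]
    split_ifs
    · exact Nat.cast_nonneg _
    · exact le_rfl
    · exact Nat.cast_nonneg _
    · exact le_rfl

/-- **`E₃` input**: under `btt_uniformity_sqDvd` (BTT Prop. 4.5) there is `C` with
`N^±(X, Ψ_{q²}) ≤ C · 6^{ω(q)} X / q²` for all squarefree `q`, both signs, all `X`. [cite: BhargavaTaniguchiThorne2023, §5 (E₃ ≪ X Σ_{q>Q} 6^{ω(q)} q^{-2}, by Prop. 4.5)] -/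
theorem exists_nonFundCount_le (hU : btt_uniformity_sqDvd) :
    ∃ C : ℝ, ∀ q : ℕ, Squarefree q → ∀ s : ℤ, (s = 1 ∨ s = -1) → ∀ X : ℕ,
      nonFundCount s q X ≤ C * 6 ^ q.primeFactors.card * X / (q : ℝ) ^ 2 := by
  obtain ⟨C, hC⟩ := hU
  exact ⟨C, fun q hq s hs X => (nonFundCount_le_sum_classNumber hs hq X).trans (hC q hq s hs X)⟩

end Literature.NumberTheory.CubicFields

end
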